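import Mathlib
import HarnessLib
import Literature.RingTheory.CohomologyAnnihilator.Basic
import Summits.ResolutionOfSingularities.ResolutionOfSingularities.Theorems.HomologicalConductorNoZenoBirthDefs
import Summits.ResolutionOfSingularities.ResolutionOfSingularities.Theorems.HomologicalConductorPersistenceLocalisation
import Summits.ResolutionOfSingularities.ResolutionOfSingularities.Theorems.HomologicalConductorPersistencePeriodicSaturationStage

/-!
# Periodic saturation at STAGE 0 of a specimen tower (`NoZeno.Birth` vocabulary)

Route `ResolutionOfSingularities/HomologicalConductor`, chain W4.4b, rung S-2 `PersistenceSurface`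
(stmt-ResolutionOfSingularities-19970); o9 lineage (p506413 · p507177 · p508342 · p509489), the
addition asked by the chain's referee res-L1-w44b-tri-1 (AUDIT-o9 6887c213a80db3b5 §5.1 / AuditO9.lean
77ecda1e3e3d4c18, STATUS 2026-08-27T07:24Z): the STAGE-0 form that takes only an AFFINE presentation
`e : ↥A ≃+* k[x₁,…,x_d][X]/(f)` (`f` monic) of the starting algebra and concludes the `Satₙ` clause at
`T₀ = tower O A 0 = loc O A`, so that the Sat₄ assembly (o11) never has to name the localisation.
[OURS · L1 w44b · res-type-011, after res-L1-w44b-tri-1; AI-written, weaker than expert review; NOT a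
statement of the manuscript under study, and no statement of that manuscript is used.]

Vocabulary: the named copies `NoZeno.Birth.ca / loc / tower` of the route's inline `let`s
(`Theorems/HomologicalConductorNoZenoBirthDefs.lean`, `mem_ca_iff`/`tower_zero`/`loc_eq_locAt` are
`rfl`), the localisation structure of `locAt O A` over `↥A`
(`PersistenceLocalisation.isLocalization_locAt`, tree), Mathlib's
`IsLocalization.ringEquivOfRingEquiv`, and the o9d adapter
`PeriodicSaturationStage.ca_subset_caAt_of_ringEquiv_localization_powerBasis`.

* `birth_ca_subset_caAt_of_ringEquiv_localization_adjoinRoot` — a stage `T` with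
  `↥T ≃+* U⁻¹(k[x₁,…,x_d][X]/(f))`, `f` monic: `NoZeno.Birth.ca T ⊆ caAt n T` for `n ≥ d + 1`;
* `nonempty_ringEquiv_loc_localization` — from `e : ↥A ≃+* AdjoinRoot f` and `A ⊆ O`:
  `↥(loc O A) ≃+* Localization (U.map e)` for the submonoid `U ⊆ ↥A` of `O`-units;
* `birth_ca_tower_zero_subset_caAt` (`n ≥ d + 1`) and `birth_ca_tower_zero_subset_caAt_four` (`d = 2`):
  the `m = 0` conjunct of `SaturationFourSurface` / `SaturationFourRational` for EVERY specimen whose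
  starting algebra is (isomorphic to) `k[x,y][X]/(f)` with `f` monic — all RDP normal forms, `zᵖ + F(x,y)`,
  any field, any characteristic, no recurrence hypothesis.

What this is NOT: later stages `m ≥ 1` (their presentation as monic-hypersurface localisations is the
assembly's input, see o9d), non-hypersurface starting algebras.
-/

noncomputable section

-- single-problem summit: the doubled namespace component `ResolutionOfSingularities` is forced
set_option linter.dupNamespace false

namespace Summit.ResolutionOfSingularities.ResolutionOfSingularities.Theorems.HomologicalConductor.PeriodicSaturationBirthStage

open CategoryTheory CategoryTheory.Abelian Literature.RingTheory.CohomologyAnnihilator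
open Summit.ResolutionOfSingularities.ResolutionOfSingularities.Theorems
open Summit.ResolutionOfSingularities.ResolutionOfSingularities.Theorems.SyzygyFlattening
  (locAt self_le_locAt)
open Summit.ResolutionOfSingularities.ResolutionOfSingularities.Theorems.HomologicalConductor.PeriodicSaturationStage

variable {k K : Type} [Field k] [Field K] [Algebra k K]

/-- **`Satₙ` at a stage presented as a monic-hypersurface localisation** (`NoZeno.Birth` vocabulary):
if `↥T ≃+* U⁻¹(k[x₁,…,x_d][X]/(f))` with `f` monic, then `NoZeno.Birth.ca T ⊆ caAt n T` for every
`n ≥ d + 1`. [OURS] -/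
theorem birth_ca_subset_caAt_of_ringEquiv_localization_adjoinRoot (T : Subalgebra k K) {d : ℕ}
    {f : Polynomial (MvPolynomial (Fin d) k)} (hf : f.Monic) (U : Submonoid (AdjoinRoot f))
    (e : ↥T ≃+* Localization U) {n : ℕ} (hn : d + 1 ≤ n) :
    NoZeno.Birth.ca T ⊆ {x : K | ∃ hx : x ∈ T, ∀ i : ℕ, n ≤ i → ∀ (M N : ModuleCat.{0} ↥T),
      Module.Finite ↥T M → Module.Finite ↥T N →
        ∀ e : CategoryTheory.Abelian.Ext.{0} M N i, (⟨x, hx⟩ : ↥T) • e = 0} := fun _ hx =>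
  ca_subset_caAt_of_ringEquiv_localization_powerBasis (AdjoinRoot.powerBasis' hf)
    (cohomologyAnnihilatorOfDegree_mvPolynomial_eq_top k d) U T e hn
    ((NoZeno.Birth.mem_ca_iff T).mp hx)

/-- **The stage-0 ring isomorphism.** From an affine presentation `e : ↥A ≃+* k[x₁,…,x_d][X]/(f)` and
`A ⊆ O`: `loc O A` (= `locAt O A`, the localisation of `↥A` at the submonoid `U` of `O`-units,
`PersistenceLocalisation.isLocalization_locAt`) is ring-isomorphic to the localisation of
`k[x₁,…,x_d][X]/(f)` at `U.map e` (Mathlib `IsLocalization.ringEquivOfRingEquiv`).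
[OURS, after res-L1-w44b-tri-1 AuditO9.lean] -/
theorem nonempty_ringEquiv_loc_localization (O : ValuationSubring K) (A : Subalgebra k K)
    (hAO : A.toSubring ≤ O.toSubring) {d : ℕ} {f : Polynomial (MvPolynomial (Fin d) k)}
    (e : ↥A ≃+* AdjoinRoot f) :
    Nonempty (↥(NoZeno.Birth.loc O A) ≃+*
      Localization (((IsUnit.submonoid ↥(locAt O A)).comap
        (Subalgebra.inclusion (self_le_locAt O A)).toRingHom).map e.toMonoidHom)) := by
  letI : Algebra ↥A ↥(locAt O A) := (Subalgebra.inclusion (self_le_locAt O A)).toRingHom.toAlgebra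
  let U : Submonoid ↥A :=
    (IsUnit.submonoid ↥(locAt O A)).comap (Subalgebra.inclusion (self_le_locAt O A)).toRingHom
  haveI : IsLocalization U ↥(locAt O A) :=
    HomologicalConductor.PersistenceLocalisation.isLocalization_locAt O A hAO
  rw [NoZeno.Birth.loc_eq_locAt]
  exact ⟨IsLocalization.ringEquivOfRingEquiv (S := ↥(locAt O A)) (M := U)
    (T := U.map e.toMonoidHom) (Q := Localization (U.map e.toMonoidHom)) e rfl⟩

/-- **Stage `0`, every `n ≥ d + 1`**: `NoZeno.Birth.ca (tower O A 0) ⊆ caAt n (tower O A 0)` for a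
starting algebra `A ≃+* k[x₁,…,x_d][X]/(f)`, `f` monic, `A ⊆ O`. [OURS, after res-L1-w44b-tri-1] -/
theorem birth_ca_tower_zero_subset_caAt (O : ValuationSubring K) (A : Subalgebra k K)
    (hAO : A.toSubring ≤ O.toSubring) {d : ℕ} {f : Polynomial (MvPolynomial (Fin d) k)}
    (hf : f.Monic) (e : ↥A ≃+* AdjoinRoot f) {n : ℕ} (hn : d + 1 ≤ n) :
    NoZeno.Birth.ca (NoZeno.Birth.tower O A 0) ⊆ {x : K | ∃ hx : x ∈ NoZeno.Birth.tower O A 0,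
      ∀ i : ℕ, n ≤ i → ∀ (M N : ModuleCat.{0} ↥(NoZeno.Birth.tower O A 0)),
      Module.Finite ↥(NoZeno.Birth.tower O A 0) M → Module.Finite ↥(NoZeno.Birth.tower O A 0) N →
        ∀ e : CategoryTheory.Abelian.Ext.{0} M N i,
          (⟨x, hx⟩ : ↥(NoZeno.Birth.tower O A 0)) • e = 0} := by
  rw [NoZeno.Birth.tower_zero]
  obtain ⟨e'⟩ := nonempty_ringEquiv_loc_localization O A hAO e
  exact birth_ca_subset_caAt_of_ringEquiv_localization_adjoinRoot _ hf _ e' hn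

/-- **Stage `0`, surface case (`d = 2`, level `4`)**: the `m = 0` conjunct of `SaturationFourSurface` /
`SaturationFourRational` for every specimen with `A ≃+* k[x,y][X]/(f)`, `f` monic — all RDP normal
forms and all `zᵖ + F(x,y)`, in every characteristic, with no recurrence hypothesis.
[OURS, after res-L1-w44b-tri-1] -/
theorem birth_ca_tower_zero_subset_caAt_four (O : ValuationSubring K) (A : Subalgebra k K)
    (hAO : A.toSubring ≤ O.toSubring) {f : Polynomial (MvPolynomial (Fin 2) k)} (hf : f.Monic)
    (e : ↥A ≃+* AdjoinRoot f) :
    NoZeno.Birth.ca (NoZeno.Birth.tower O A 0) ⊆ {x : K | ∃ hx : x ∈ NoZeno.Birth.tower O A 0,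
      ∀ i : ℕ, 4 ≤ i → ∀ (M N : ModuleCat.{0} ↥(NoZeno.Birth.tower O A 0)),
      Module.Finite ↥(NoZeno.Birth.tower O A 0) M → Module.Finite ↥(NoZeno.Birth.tower O A 0) N →
        ∀ e : CategoryTheory.Abelian.Ext.{0} M N i,
          (⟨x, hx⟩ : ↥(NoZeno.Birth.tower O A 0)) • e = 0} :=
  birth_ca_tower_zero_subset_caAt O A hAO hf e (by norm_num)

end Summit.ResolutionOfSingularities.ResolutionOfSingularities.Theorems.HomologicalConductor.PeriodicSaturationBirthStage

end
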